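import Literature.NumberTheory.NumberFields.SplitPrimesGaloisClosure
import Literature.NumberTheory.NumberFields.BauerSplitPrimes
import HarnessLib

/-!
# Bauer's theorem with degree-one places of an ARBITRARY number field
# ([FrdI] Thm. 6.4 (iv), proof: "[again by Tchebotarev's density theorem — cf., e.g., [NSW],
# Theorem 12.2.5] that `L₁ ⊆ L₂`")

Mochizuki, *The geometry of Frobenioids I* (2008), proof of Theorem 6.4 (iv), kurims text p. 116
l. 29–33: "Since `L₁` is Galois, it thus follows from the fact that deg(Ψ^rlf) = 1 [i.e., so for each
prime that splits in `L₂` there is a prime of the same residue characteristic — hence by (iii) the same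
residue field degree one — in `L₁`, which (as `L₁` is Galois) therefore splits completely in `L₁`] —
again by Tchebotarev's density theorem — cf., e.g., [NSW], Theorem 12.2.5 — that `L₁ ⊆ L₂`".
[cite: MochizukiFrdI2008, Thm. 6.4 (iv) p.116]

The classical input is M. Bauer's theorem in the form of Neukirch–Schmidt–Wingberg, *Cohomology of
Number Fields*, Thm. 12.2.5 / Neukirch, *Algebraic Number Theory* VII (13.9): **if `L₁/ℚ` is Galois and
`L₂` is an ARBITRARY number field such that all but finitely many rational primes `p` possessing a place
of `L₂` of residue degree one split completely in `L₁`, then `L₁` embeds into `L₂`.**  The tree's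
`NumberFields/BauerSplitPrimes` proves Bauer for pairs of GALOIS subextensions; this PROOF-ONLY file
(theorems, no definitions, no named facts) proves the stronger form above, by the same Frobenius
argument run over the base `L₂`: inside the Galois closure `K` of `L₁ L₂`, every `g ∈ Gal(K/L₂)` is the
Frobenius at a prime `Q` of `K` above a degree-one prime `q` of `L₂` (the tree's finite-level Chebotarev
`infinite_setOf_exists_isArithFrobAt` over `L₂`); `p = N q` has the degree-one place `q` in `L₂`, so `p`
splits completely in `L₁`, so the decomposition group of `Q` fixes `L₁` (Marcus Ch. 4, Cor. to
Thm. 29: `NumberFields/DecompositionFieldExtremal`), so `g` fixes `L₁`; hence `Gal(K/L₂) ≤ Gal(K/L₁)`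
and `L₁ ⊆ L₂` by the Galois correspondence.

* `absNorm_comap_ringEquiv` — absolute norms are invariant under ring isomorphisms;
* `nonempty_algHom_of_degreeOne_splitsCompletely` — **Bauer, degree-one form** (the statement above,
  conclusion `Nonempty (L₁ →ₐ[ℚ] L₂)`).

Classical algebraic number theory; nothing here is specific to, or takes a side on, the disputed corpus.
-/

noncomputable section

open NumberField IsDedekindDomain Ideal
open Literature.NumberTheory.GaloisRepresentations

open scoped Pointwise Classical

namespace Literature.NumberTheory.NumberFields

/-! ### Absolute norms along ring isomorphisms -/

section AbsNorm

variable {L L' : Type} [Field L] [NumberField L] [Field L'] [NumberField L']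

/-- The absolute norm of an ideal is invariant under a ring isomorphism `g : 𝓞 L' ≃ 𝓞 L` (pull-back):
`#(𝓞 L' / g⁻¹ I) = #(𝓞 L / I)`. [cite: Marcus2018, Ch. 3 (before Thm. 22)] -/
theorem absNorm_comap_ringEquiv (g : 𝓞 L' ≃+* 𝓞 L) (I : Ideal (𝓞 L)) :
    absNorm (I.comap (g : 𝓞 L' →+* 𝓞 L)) = absNorm I := by
  rw [Ideal.absNorm_apply, Ideal.absNorm_apply, Submodule.cardQuot_apply, Submodule.cardQuot_apply]
  refine Nat.card_congr (Ideal.quotientEquiv (I.comap (g : 𝓞 L' →+* 𝓞 L)) I g ?_).toEquiv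
  rw [Ideal.map_comap_of_surjective (g : 𝓞 L' →+* 𝓞 L) g.surjective]

/-- A degree-one prime transported along an isomorphism of number fields: if `L ≃ L'` then for every
prime `q` of `L'` there is a prime of `L` with the same absolute norm. [cite: Marcus2018, Ch. 3 (before Thm. 22)] -/
theorem exists_absNorm_eq_of_algEquiv (e : L ≃ₐ[ℚ] L') (q : HeightOneSpectrum (𝓞 L')) :
    ∃ w : HeightOneSpectrum (𝓞 L), absNorm w.asIdeal = absNorm q.asIdeal := by
  set g : 𝓞 L ≃+* 𝓞 L' := RingOfIntegers.mapRingEquiv (e : L ≃+* L') with hg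
  haveI := q.isPrime
  have hne : q.asIdeal.comap (g : 𝓞 L →+* 𝓞 L') ≠ ⊥ := by
    intro h
    apply q.ne_bot
    have := congrArg (Ideal.map (g : 𝓞 L →+* 𝓞 L')) h
    rwa [Ideal.map_comap_of_surjective (g : 𝓞 L →+* 𝓞 L') g.surjective, Ideal.map_bot] at this
  exact ⟨⟨q.asIdeal.comap (g : 𝓞 L →+* 𝓞 L'), Ideal.comap_isPrime _ _, hne⟩,
    absNorm_comap_ringEquiv g q.asIdeal⟩

/-- Only finitely many primes of `L` have absolute norm in a given finite set (each divides `(n)`).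
[folklore] -/
private theorem finite_setOf_absNorm_mem (S : Finset ℕ) :
    {w : HeightOneSpectrum (𝓞 L) | absNorm w.asIdeal ∈ S}.Finite := by
  refine (Set.Finite.biUnion S.finite_toSet (t := fun n => {w : HeightOneSpectrum (𝓞 L) | absNorm w.asIdeal = n})
    fun n _ => ?_).subset fun w hw => Set.mem_biUnion hw rfl
  by_cases hn : 1 < n
  · have hn0 : (Ideal.span {((n : ℕ) : 𝓞 L)}) ≠ ⊥ := by
      rw [ne_eq, Ideal.span_singleton_eq_bot]
      exact_mod_cast (show n ≠ 0 by omega)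
    refine (Ideal.finite_factors hn0).subset fun w hw => ?_
    simp only [Set.mem_setOf_eq] at hw ⊢
    rw [Ideal.dvd_span_singleton, ← hw]
    exact Ideal.absNorm_mem w.asIdeal
  · refine (Set.finite_empty).subset fun w hw => ?_
    simp only [Set.mem_setOf_eq] at hw
    exact absurd (hw ▸ NumberField.HeightOneSpectrum.one_lt_absNorm w) hn

end AbsNorm

/-! ### Bauer's theorem, degree-one form -/

section Bauer

variable (L₁ L₂ : Type) [Field L₁] [NumberField L₁] [Field L₂] [NumberField L₂]

/-- **Bauer's theorem, degree-one form** ([NSW] Thm. 12.2.5; Neukirch VII (13.9); as used in [FrdI]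
Thm. 6.4 (iv), proof p. 116 l. 29–33): let `L₁/ℚ` be Galois and `L₂` an arbitrary number field. If every
rational prime `p` outside a finite set `S` that possesses a place of `L₂` of residue degree one (absolute
norm `p`) splits completely in `L₁`, then `L₁` embeds into `L₂` (over `ℚ`).
[cite: NeukirchANT1999, Ch. VII Prop. (13.9)] [cite: MochizukiFrdI2008, Thm. 6.4 (iv) p.116] -/
theorem nonempty_algHom_of_degreeOne_splitsCompletely [IsGalois ℚ L₁] (S : Finset ℕ)
    (h : ∀ p : ℕ, p.Prime → p ∉ S →
      (∃ w : HeightOneSpectrum (𝓞 L₂), absNorm w.asIdeal = p) → SplitsCompletely L₁ p) :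
    Nonempty (L₁ →ₐ[ℚ] L₂) := by
  -- the Galois closure `K` of `L₁ L₂` over `ℚ` inside `Ω = L̄₂`
  let Ω := AlgebraicClosure L₂
  haveI : IsAlgClosure ℚ Ω :=
    ⟨AlgebraicClosure.isAlgClosed L₂, Algebra.IsAlgebraic.trans ℚ L₂ Ω⟩
  haveI : IsGalois ℚ Ω := IsAlgClosure.isGalois ℚ Ω
  let ι₁ : L₁ →ₐ[ℚ] Ω := IsAlgClosed.lift
  let ι₂ : L₂ →ₐ[ℚ] Ω := IsScalarTower.toAlgHom ℚ L₂ Ω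
  let E : IntermediateField ℚ Ω := ι₁.fieldRange ⊔ ι₂.fieldRange
  haveI : FiniteDimensional ℚ ι₁.fieldRange :=
    LinearEquiv.finiteDimensional (AlgEquiv.ofInjectiveField ι₁).toLinearEquiv
  haveI : FiniteDimensional ℚ ι₂.fieldRange :=
    LinearEquiv.finiteDimensional (AlgEquiv.ofInjectiveField ι₂).toLinearEquiv
  let K : IntermediateField ℚ Ω := IntermediateField.normalClosure ℚ E Ω
  haveI : IsGalois ℚ K := IsGalois.normalClosure ℚ E Ω
  haveI : NumberField K := NumberField.of_module_finite ℚ K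
  have hEK : E ≤ K := IntermediateField.le_normalClosure E
  -- `L₁ ≅ M₁ ⊆ K`, `L₂ ≅ M₂ ⊆ K`
  let φ₁ : L₁ →ₐ[ℚ] K :=
    (IntermediateField.inclusion (le_sup_left.trans hEK)).comp (AlgEquiv.ofInjectiveField ι₁).toAlgHom
  let φ₂ : L₂ →ₐ[ℚ] K :=
    (IntermediateField.inclusion (le_sup_right.trans hEK)).comp (AlgEquiv.ofInjectiveField ι₂).toAlgHom
  let M₁ : IntermediateField ℚ K := φ₁.fieldRange
  let M₂ : IntermediateField ℚ K := φ₂.fieldRange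
  let e₁ : L₁ ≃ₐ[ℚ] M₁ := AlgEquiv.ofInjectiveField φ₁
  let e₂ : L₂ ≃ₐ[ℚ] M₂ := AlgEquiv.ofInjectiveField φ₂
  haveI : IsGalois ℚ M₁ := IsGalois.of_algEquiv e₁
  haveI : NumberField M₁ := NumberField.of_module_finite ℚ M₁
  haveI : NumberField M₂ := NumberField.of_module_finite ℚ M₂
  haveI : IsGalois M₂ K := IsGalois.tower_top_of_isGalois ℚ M₂ K
  -- it suffices that `M₁ ≤ M₂`, i.e. `Gal(K/M₂) ≤ Gal(K/M₁)`
  suffices hle : M₂.fixingSubgroup ≤ M₁.fixingSubgroup by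
    have hM : M₁ ≤ M₂ := by
      have := (IntermediateField.le_iff_le _ _).mpr hle
      rwa [IsGalois.fixedField_fixingSubgroup] at this
    exact ⟨(e₂.symm.toAlgHom.comp (IntermediateField.inclusion hM)).comp e₁.toAlgHom⟩
  intro g hg
  -- `g` as an element of `Gal(K/M₂)`, and a degree-one prime `q` of `M₂` with Frobenius `g`
  set g' : K ≃ₐ[M₂] K := M₂.fixingSubgroupEquiv ⟨g, hg⟩ with hg'def
  have hg'g : g'.restrictScalars ℚ = g := AlgEquiv.ext fun _ => rfl
  have hbad : ({q : HeightOneSpectrum (𝓞 M₂) | absNorm q.asIdeal ∈ S}).Finite :=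
    finite_setOf_absNorm_mem S
  obtain ⟨q, ⟨hprime, hunr, Q, hQ, hfrob⟩, hqS⟩ :=
    ((infinite_setOf_exists_isArithFrobAt (F := M₂) (L := K) g').sdiff hbad).nonempty
  simp only [Set.mem_setOf_eq] at hqS
  set p : ℕ := absNorm q.asIdeal with hp
  -- `p` has a degree-one place in `L₂`, hence splits completely in `L₁`, hence in `M₁`
  obtain ⟨w, hw⟩ := exists_absNorm_eq_of_algEquiv e₂ q
  have hsplit : SplitsCompletely M₁ p :=
    splitsCompletely_of_algEquiv e₁ hprime (h p hprime hqS ⟨w, hw⟩)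
  -- `Q` lies over `p`
  haveI := hQ.1
  haveI := hQ.2
  haveI : Fact p.Prime := ⟨hprime⟩
  have hpq : ((p : ℕ) : 𝓞 M₂) ∈ q.asIdeal := by
    rw [hp]
    exact Ideal.absNorm_mem q.asIdeal
  haveI : q.asIdeal.LiesOver (span {(p : ℤ)}) := liesOver_span_of_natCast_mem_asIdeal hprime q hpq
  haveI : Q.LiesOver (span {(p : ℤ)}) := Ideal.LiesOver.trans Q q.asIdeal (span {(p : ℤ)})
  -- the decomposition group of `Q` fixes the Galois `M₁` (Marcus Ch. 4, Cor. to Thm. 29) ...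
  have hD : MulAction.stabilizer (K ≃ₐ[ℚ] K) Q ≤ M₁.fixingSubgroup :=
    (stabilizer_le_fixingSubgroup_iff_splitsCompletely M₁ Q p).mpr hsplit
  -- ... and contains the Frobenius `g`
  have hgQ : g ∈ MulAction.stabilizer (K ≃ₐ[ℚ] K) Q := by
    have h1 : g' ∈ MulAction.stabilizer (K ≃ₐ[M₂] K) Q := hfrob.mem_stabilizer
    rw [MulAction.mem_stabilizer_iff] at h1 ⊢
    rw [← hg'g, Ideal.pointwise_smul_def] at *
    have hhom : MulSemiringAction.toRingHom (K ≃ₐ[ℚ] K) (𝓞 K) (g'.restrictScalars ℚ) =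
        MulSemiringAction.toRingHom (K ≃ₐ[M₂] K) (𝓞 K) g' :=
      RingHom.ext fun x => RingOfIntegers.restrictScalars_smul M₂ g' x
    rw [hhom]
    exact h1
  exact hD hgQ

end Bauer

end Literature.NumberTheory.NumberFields

end
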